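import Literature.NumberTheory.Transcendental.AnalytificationConnectedProofs
import HarnessLib

/-!
# Connectedness in the complex topology of an open part of an irreducible closed subvariety

Companion to `AnalytificationConnected.lean` / `AnalytificationConnectedProofs.lean` (the tree's
theorem `ComplexPoints.isConnected_setOf_pt_mem_of_isIrreducible_holds`: for a scheme `X` locally
of finite type over `ℂ` and a CLOSED irreducible `Z ⊆ X`, `Z(ℂ) = {P ∈ X(ℂ) | P.pt ∈ Z}` is
connected in the strong topology; SGA1 XII Prop. 2.4, Shafarevich VII §2 Thm. 7.1: «If `X` is an
irreducible algebraic variety over `ℂ`, then `X(ℂ)` is connected»). This file records the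
LOCALLY CLOSED form: for `W ⊆ X` open and `C ⊆ X` closed irreducible meeting `W`,
`{P ∈ X(ℂ) | P.pt ∈ C ∩ W}` is connected (`isConnected_setOf_pt_mem_inter_of_isIrreducible`) —
Shafarevich's theorem for the irreducible quasi-projective variety `C ∩ W`. Proof: `C ∩ W` is a
closed irreducible subset of the open subscheme `W`, itself locally of finite type over `ℂ`, so
the closed form applies on `W`; and `W(ℂ) → X(ℂ)` is a topological (open) embedding with image
`{P | P.pt ∈ W}` (SGA1 XII Thm. 1.1 proof a); the tree's `AlgPoints.continuous_map`,
`AlgPoints.range_map_of_isOpenImmersion_holds`), carrying `(C ∩ W)(ℂ)` onto the set in question.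
Typical use (`isConnected_setOf_pt_mem_diff_of_isIrreducible`): an irreducible curve minus
finitely many closed points — e.g. its singular points — has a connected set of complex points
(the smooth locus `C ∖ Sing C` of an irreducible curve `C` on a smooth projective threefold, in the
support calculus of `Literature/Barriers/HodgeConjecture/IntegralCoefficientsKollarCurves`).

Everything is proved; no named facts.

## References

* [Shafarevich1994] I. R. Shafarevich, Basic Algebraic Geometry 2, Book 3 Ch. VII §2 Thm. 7.1.
* [SGA1] A. Grothendieck, SGA1, Exp. XII Prop. 2.4, Thm. 1.1 (proof a)).
-/

noncomputable section

open CategoryTheory AlgebraicGeometry Set Topology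

namespace Literature.NumberTheory.Transcendental

section ComplexPoints

open Literature.AlgebraicGeometry.Motives

variable (X : SchemeOver ℂ) [LocallyOfFiniteType X.hom]

/-- **An open part of an irreducible closed subvariety is connected in the complex topology.**
For `X` locally of finite type over `ℂ`, `W ⊆ X` open and `C ⊆ X` closed irreducible with
`C ∩ W ≠ ∅`, the set `{P ∈ X(ℂ) | P.pt ∈ C, P.pt ∈ W}` is connected (Shafarevich VII §2 Thm. 7.1
for the irreducible variety `C ∩ W`; from the closed case on the open subscheme `W`, transported
along the embedding `W(ℂ) ↪ X(ℂ)`). [cite: Shafarevich1994, Book 3 Ch. VII §2 Thm. 7.1]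
[cite: SGA1, Exp. XII Prop. 2.4 and Thm. 1.1 proof a)] -/
theorem _root_.Literature.AlgebraicGeometry.Motives.ComplexPoints.isConnected_setOf_pt_mem_inter_of_isIrreducible
    {C : Set X.left} (hC : IsClosed C) (hCi : IsIrreducible C) (W : X.left.Opens)
    (hCW : (C ∩ (W : Set X.left)).Nonempty) :
    IsConnected {P : ComplexPoints X | P.pt ∈ C ∧ P.pt ∈ (W : Set X.left)} := by
  -- the open subscheme `W`, as a scheme over `ℂ`, and its open immersion `φ : W ⟶ X` over `ℂ`
  let U : SchemeOver ℂ := Over.mk (W.ι ≫ X.hom)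
  let φ : U ⟶ X := Over.homMk W.ι rfl
  haveI : IsOpenImmersion φ.left := inferInstanceAs (IsOpenImmersion W.ι)
  haveI : LocallyOfFiniteType U.hom := inferInstanceAs (LocallyOfFiniteType (W.ι ≫ X.hom))
  -- `C ∩ W` as a closed irreducible subset of `W`
  have hZc : IsClosed ((fun w ↦ W.ι w) ⁻¹' C : Set U.left) := hC.preimage W.ι.continuous
  have hZi : IsIrreducible ((fun w ↦ W.ι w) ⁻¹' C : Set U.left) := by
    refine hCi.preimage W.ι.isOpenEmbedding ?_
    obtain ⟨z, hzC, hzW⟩ := hCW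
    exact ⟨z, hzC, ⟨z, hzW⟩, rfl⟩
  have hconn := ComplexPoints.isConnected_setOf_pt_mem_of_isIrreducible_holds U hZc hZi
  -- transport along `map φ : W(ℂ) → X(ℂ)`
  have himage : (AlgPoints.map φ) '' {Q : ComplexPoints U | Q.pt ∈ ((fun w ↦ W.ι w) ⁻¹' C : Set U.left)}
      = {P : ComplexPoints X | P.pt ∈ C ∧ P.pt ∈ (W : Set X.left)} := by
    ext P
    constructor
    · rintro ⟨Q, hQ, rfl⟩
      refine ⟨?_, ?_⟩
      · show (AlgPoints.map φ Q).pt ∈ C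
        rw [AlgPoints.pt_map]
        exact hQ
      · show (AlgPoints.map φ Q).pt ∈ (W : Set X.left)
        rw [AlgPoints.pt_map]
        exact (Q.pt).2
    · rintro ⟨hPC, hPW⟩
      have hP : P ∈ Set.range (AlgPoints.map φ : ComplexPoints U → ComplexPoints X) := by
        rw [AlgPoints.range_map_of_isOpenImmersion_holds φ]
        change P.pt ∈ (W.ι.opensRange : Set X.left)
        rw [Scheme.Opens.opensRange_ι]
        exact hPW
      obtain ⟨Q, rfl⟩ := hP
      refine ⟨Q, ?_, rfl⟩
      show W.ι Q.pt ∈ C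
      rw [AlgPoints.pt_map] at hPC
      exact hPC
  rw [← himage]
  exact hconn.image _ (AlgPoints.continuous_map φ).continuousOn

/-- **An irreducible closed subvariety minus a finite set of closed points is connected in the
complex topology** (when non-empty): for `C ⊆ X` closed irreducible and `S ⊆ X` a finite set of
closed points not containing `C`, `{P ∈ X(ℂ) | P.pt ∈ C, P.pt ∉ S}` is connected — e.g. the smooth
locus of an irreducible curve. [cite: Shafarevich1994, Book 3 Ch. VII §2 Thm. 7.1] -/
theorem _root_.Literature.AlgebraicGeometry.Motives.ComplexPoints.isConnected_setOf_pt_mem_diff_of_isIrreducible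
    {C : Set X.left} (hC : IsClosed C) (hCi : IsIrreducible C) {S : Set X.left} (hS : S.Finite)
    (hSc : ∀ s ∈ S, IsClosed ({s} : Set X.left)) (hCS : ¬ C ⊆ S) :
    IsConnected {P : ComplexPoints X | P.pt ∈ C ∧ P.pt ∉ S} := by
  have hSclosed : IsClosed S := by
    rw [← biUnion_of_singleton S]
    exact hS.isClosed_biUnion fun s hs ↦ hSc s hs
  obtain ⟨z, hzC, hzS⟩ := not_subset.mp hCS
  exact ComplexPoints.isConnected_setOf_pt_mem_inter_of_isIrreducible X hC hCi ⟨Sᶜ, hSclosed.isOpen_compl⟩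
    ⟨z, hzC, hzS⟩

end ComplexPoints

end Literature.NumberTheory.Transcendental

end
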